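import Mathlib.Data.ZMod.Basic
import Mathlib.Data.Real.Basic
import Mathlib.Analysis.SpecialFunctions.Pow.Real
import Mathlib.Algebra.BigOperators.Fin
import Mathlib.Tactic
import HarnessLib

/-!
# OddPrimeWalk — sign-walk core I: transfer operators of the fair `0/+1` walk on `ℤ₃` with `±1` site factors

Support machinery for item stmt-QuantumAdvantage-24332 `SignWalkFloorThree` (route OddPrimeWalk, planner qa-qnc0-p2
g32, PROOF-BB L2–L5; prover qn-prover-3 g20).  Elementary linear algebra on `ℝ^{ℤ₃}`:

* `step d v z = d z · (v z + v (z-1))` — one UN-normalised walk step (stay / `+1`) followed by a site factor `d`;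
  `evo m F v` — `m` steps with site factors `F 1, …, F m` (site `j` acts right after step `j`).
* PATH-SUM FORMULA `evo_eq_pathsum`: `evo m F v z = Σ_{b ∈ {0,1}^m} Σ_{z₀} [z₀ + |b| = z]·v z₀·Π_{j=1}^{m} F j (z₀ + |b_{<j}|)`
  (prefix counts mod 3 in the literal form of the item: `pre`, `wtZ`), proved once by peeling the first bit
  (`Fin.consEquiv`); composition `evo_add`, last-step form `evo_last`, congruence `evo_congr`, linearity in the initial
  vector, and the read-outs `sum_evo_eq`, `evo_ones_apply`, `sum_evo_delta`, `evo_delta_apply`.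

Part II (`OddPrimeWalkSignWalkBounds`): growth bounds, the unit contraction, the parity core, weight counts mod 3.
WHAT THIS IS NOT: no ring-game objects; the item itself is closed in `OddPrimeWalkSignWalkFloor.lean`.
-/

namespace Summit.QuantumAdvantage.AdviceFreeQNC0.SignWalk

open Finset

/-! ## §0 Arithmetic on `ZMod 3` -/

/-- `Σ_{z ∈ ℤ₃} f z = f 0 + f 1 + f 2`. -/
theorem sum3 (f : ZMod 3 → ℝ) : ∑ z, f z = f 0 + f 1 + f 2 := Fin.sum_univ_three f
/-- `Π_{z ∈ ℤ₃} f z = f 0 · f 1 · f 2`. -/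
theorem prod3 (f : ZMod 3 → ℝ) : ∏ z, f z = f 0 * f 1 * f 2 := Fin.prod_univ_three f
/-- `0 ≠ 1` in `ℤ₃`. -/
theorem z3_01 : (0 : ZMod 3) ≠ 1 := by decide
/-- `0 ≠ 2` in `ℤ₃`. -/
theorem z3_02 : (0 : ZMod 3) ≠ 2 := by decide
/-- `1 ≠ 2` in `ℤ₃`. -/
theorem z3_12 : (1 : ZMod 3) ≠ 2 := by decide
/-- `0 - 1 = 2` in `ℤ₃`. -/
theorem z3_0s : (0 : ZMod 3) - 1 = 2 := by decide
/-- `1 - 1 = 0` in `ℤ₃`. -/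
theorem z3_1s : (1 : ZMod 3) - 1 = 0 := by decide
/-- `2 - 1 = 1` in `ℤ₃`. -/
theorem z3_2s : (2 : ZMod 3) - 1 = 1 := by decide
/-- Trichotomy in `ℤ₃`. -/
theorem z3_cases (c : ZMod 3) : c = 0 ∨ c = 1 ∨ c = 2 := by revert c; decide

/-! ## §1 The transfer operators -/

/-- One un-normalised walk step (stay or `+1`) followed by the site factor `d`. -/
def step (d v : ZMod 3 → ℝ) : ZMod 3 → ℝ := fun z => d z * (v z + v (z - 1))

/-- `m` steps; the factor of site `j ∈ [1, m]` is `F j`, applied right after step `j`. -/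
def evo : ℕ → (ℕ → ZMod 3 → ℝ) → (ZMod 3 → ℝ) → ZMod 3 → ℝ
  | 0, _, v => v
  | m + 1, F, v => evo m (fun j => F (j + 1)) (step (F 1) v)

/-- Zero steps: the identity. -/
@[simp] theorem evo_zero (F : ℕ → ZMod 3 → ℝ) (v : ZMod 3 → ℝ) : evo 0 F v = v := rfl

/-- First-step peeling (the defining recursion). -/
theorem evo_succ (m : ℕ) (F : ℕ → ZMod 3 → ℝ) (v : ZMod 3 → ℝ) :
    evo (m + 1) F v = evo m (fun j => F (j + 1)) (step (F 1) v) := rfl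

/-- Composition: `m₁` steps, then `m₂` more steps with the shifted site factors. -/
theorem evo_add (m₁ m₂ : ℕ) (F : ℕ → ZMod 3 → ℝ) (v : ZMod 3 → ℝ) :
    evo (m₁ + m₂) F v = evo m₂ (fun j => F (j + m₁)) (evo m₁ F v) := by
  induction m₁ generalizing F v with
  | zero => simp
  | succ m₁ ih =>
    -- the shifted factor families agree definitionally (`j + m₁ + 1` and `j + (m₁ + 1)`)
    rw [Nat.add_right_comm, evo_succ, ih, evo_succ]
    congr 1

/-- Last-step peeling. -/
theorem evo_last (m : ℕ) (F : ℕ → ZMod 3 → ℝ) (v : ZMod 3 → ℝ) :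
    evo (m + 1) F v = step (F (m + 1)) (evo m F v) := by
  rw [evo_add m 1 F v, evo_succ, evo_zero, Nat.add_comm]

/-- `evo m F v` only depends on the factors of the sites `1, …, m`. -/
theorem evo_congr (m : ℕ) {F G : ℕ → ZMod 3 → ℝ} (h : ∀ j, 1 ≤ j → j ≤ m → F j = G j)
    (v : ZMod 3 → ℝ) : evo m F v = evo m G v := by
  induction m generalizing F G v with
  | zero => rfl
  | succ m ih =>
    rw [evo_succ, evo_succ, h 1 le_rfl (by omega)]
    exact ih (fun j hj hjm => h (j + 1) (by omega) (by omega)) _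

/-- `step d` is additive. -/
theorem step_add (d u v : ZMod 3 → ℝ) : step d (u + v) = step d u + step d v := by
  funext z; simp only [step, Pi.add_apply]; ring

/-- `step d` is homogeneous. -/
theorem step_smul (d : ZMod 3 → ℝ) (c : ℝ) (v : ZMod 3 → ℝ) : step d (c • v) = c • step d v := by
  funext z; simp only [step, Pi.smul_apply, smul_eq_mul]; ring

/-- Additivity in the initial vector. -/
theorem evo_add_init (m : ℕ) (F : ℕ → ZMod 3 → ℝ) (u v : ZMod 3 → ℝ) :
    evo m F (u + v) = evo m F u + evo m F v := by
  induction m generalizing F u v with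
  | zero => rfl
  | succ m ih => rw [evo_succ, evo_succ, evo_succ, step_add, ih]

/-- Homogeneity in the initial vector. -/
theorem evo_smul_init (m : ℕ) (F : ℕ → ZMod 3 → ℝ) (c : ℝ) (v : ZMod 3 → ℝ) :
    evo m F (c • v) = c • evo m F v := by
  induction m generalizing F v with
  | zero => rfl
  | succ m ih => rw [evo_succ, evo_succ, step_smul, ih]

/-! ## §2 The path-sum formula -/

/-- Prefix count mod 3: the number of set bits among the first `j` of `b ∈ {0,1}^m` (literal form of the item). -/
def pre (m : ℕ) (b : Fin m → Bool) (j : ℕ) : ZMod 3 :=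
  ((univ.filter fun i : Fin m => i.val < j ∧ b i = true).card : ℕ)

/-- Total count mod 3 (literal form of the item). -/
def wtZ (m : ℕ) (b : Fin m → Bool) : ZMod 3 :=
  ((univ.filter fun i : Fin m => b i = true).card : ℕ)

/-- No bits lie before site `0`. -/
@[simp] theorem pre_zero_site (m : ℕ) (b : Fin m → Bool) : pre m b 0 = 0 := by
  simp [pre]

/-- From site `m` on, the prefix count is the total count. -/
theorem pre_of_le (m : ℕ) (b : Fin m → Bool) {j : ℕ} (hj : m ≤ j) : pre m b j = wtZ m b := by
  unfold pre wtZ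
  congr 2
  ext i
  simp only [mem_filter, mem_univ, true_and, and_iff_right_iff_imp]
  intro _; omega

/-- The bit indicator as an element of `ℤ₃`. -/
def bitZ (β : Bool) : ZMod 3 := if β then 1 else 0

/-- Total count after prepending a bit. -/
theorem wtZ_cons (m : ℕ) (β : Bool) (b : Fin m → Bool) :
    wtZ (m + 1) (Fin.cons β b : Fin (m + 1) → Bool) = bitZ β + wtZ m b := by
  unfold wtZ bitZ
  rw [Fin.card_filter_univ_succ' (fun i : Fin (m + 1) => (Fin.cons β b : Fin (m + 1) → Bool) i = true)]
  simp only [Fin.cons_zero, Fin.cons_succ, Nat.cast_add]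
  cases β <;> simp

/-- Prefix counts after prepending a bit. -/
theorem pre_cons_succ (m : ℕ) (β : Bool) (b : Fin m → Bool) (j : ℕ) :
    pre (m + 1) (Fin.cons β b : Fin (m + 1) → Bool) (j + 1) = bitZ β + pre m b j := by
  unfold pre bitZ
  rw [Fin.card_filter_univ_succ' (fun i : Fin (m + 1) =>
    i.val < j + 1 ∧ (Fin.cons β b : Fin (m + 1) → Bool) i = true)]
  simp only [Fin.cons_zero, Fin.cons_succ, Fin.val_zero, Nat.zero_lt_succ, true_and, Fin.val_succ,
    Nat.add_lt_add_iff_right, Nat.cast_add]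
  cases β <;> simp

/-- Peeling the first bit of a sum over `{0,1}^{m+1}`. -/
theorem sum_cons (m : ℕ) (f : (Fin (m + 1) → Bool) → ℝ) :
    ∑ b, f b = ∑ β : Bool, ∑ b : Fin m → Bool, f (Fin.cons β b) := by
  rw [← Fintype.sum_prod_type']
  exact (Fintype.sum_equiv (Fin.consEquiv fun _ => Bool) _ _ (fun p => rfl)).symm

/-- The path sum: `Σ_b Σ_{z₀} [z₀ + |b| = z] · v z₀ · Π_{i < m} F (i+1) (z₀ + pre b (i+1))`. -/
def pathsum (m : ℕ) (F : ℕ → ZMod 3 → ℝ) (v : ZMod 3 → ℝ) (z : ZMod 3) : ℝ :=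
  ∑ b : Fin m → Bool, ∑ z₀ : ZMod 3,
    if z₀ + wtZ m b = z then v z₀ * ∏ i ∈ range m, F (i + 1) (z₀ + pre m b (i + 1)) else 0

/-- **Path-sum formula.** -/
theorem evo_eq_pathsum (m : ℕ) (F : ℕ → ZMod 3 → ℝ) (v : ZMod 3 → ℝ) (z : ZMod 3) :
    evo m F v z = pathsum m F v z := by
  induction m generalizing F v z with
  | zero =>
    simp [pathsum, wtZ]
  | succ m ih =>
    rw [evo_succ, ih]
    unfold pathsum
    rw [sum_cons]
    -- right-hand side: peel the first bit `β`
    have hR : ∀ (β : Bool) (b : Fin m → Bool),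
        (∑ z₀ : ZMod 3, if z₀ + wtZ (m + 1) (Fin.cons β b : Fin (m + 1) → Bool) = z then
            v z₀ * ∏ i ∈ range (m + 1), F (i + 1) (z₀ + pre (m + 1) (Fin.cons β b : Fin (m + 1) → Bool) (i + 1))
          else 0)
        = ∑ z₁ : ZMod 3, if z₁ + wtZ m b = z then
            (v (z₁ - bitZ β) * F 1 z₁) * ∏ i ∈ range m, F (i + 1 + 1) (z₁ + pre m b (i + 1)) else 0 := by
      intro β b
      -- reindex `z₀ = z₁ - bitZ β`
      rw [← (Equiv.subRight (bitZ β)).sum_comp]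
      refine sum_congr rfl fun z₁ _ => ?_
      simp only [Equiv.subRight_apply, wtZ_cons]
      have e1 : z₁ - bitZ β + (bitZ β + wtZ m b) = z₁ + wtZ m b := by ring
      rw [e1]
      by_cases hz : z₁ + wtZ m b = z
      · rw [if_pos hz, if_pos hz, prod_range_succ' (fun i => F (i + 1) _)]
        simp only [pre_cons_succ, pre_zero_site, add_zero]
        have e2 : z₁ - bitZ β + bitZ β = z₁ := by ring
        have e3 : ∀ i, z₁ - bitZ β + (bitZ β + pre m b (i + 1)) = z₁ + pre m b (i + 1) := fun i => by ring
        simp only [e2, e3]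
        ring
      · rw [if_neg hz, if_neg hz]
    simp only [hR]
    -- left-hand side: expand `step`
    rw [Fintype.sum_bool]
    rw [← sum_add_distrib]
    refine sum_congr rfl fun b _ => ?_
    rw [← sum_add_distrib]
    refine sum_congr rfl fun z₁ _ => ?_
    by_cases hz : z₁ + wtZ m b = z
    · simp only [if_pos hz, step, bitZ, Bool.false_eq_true, if_true, if_false, sub_zero]
      ring
    · simp only [if_neg hz, add_zero]

/-- Summing the path sum over the endpoint removes the endpoint constraint. -/
theorem sum_evo_eq (m : ℕ) (F : ℕ → ZMod 3 → ℝ) (v : ZMod 3 → ℝ) :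
    ∑ z, evo m F v z = ∑ b : Fin m → Bool, ∑ z₀ : ZMod 3,
      v z₀ * ∏ i ∈ range m, F (i + 1) (z₀ + pre m b (i + 1)) := by
  simp only [evo_eq_pathsum, pathsum]
  rw [sum_comm]
  refine sum_congr rfl fun b _ => ?_
  rw [sum_comm]
  refine sum_congr rfl fun z₀ _ => ?_
  rw [sum_ite_eq]
  simp

/-- The evolution of the all-ones vector, read at `w`: a path sum from the free start `w − |b|`. -/
theorem evo_ones_apply (m : ℕ) (F : ℕ → ZMod 3 → ℝ) (w : ZMod 3) :
    evo m F (fun _ => 1) w = ∑ b : Fin m → Bool,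
      ∏ i ∈ range m, F (i + 1) (w - wtZ m b + pre m b (i + 1)) := by
  rw [evo_eq_pathsum]
  unfold pathsum
  refine sum_congr rfl fun b _ => ?_
  rw [sum_eq_single (w - wtZ m b)]
  · simp
  · intro z₀ _ hne
    rw [if_neg]
    intro h; apply hne; rw [← h]; ring
  · simp

/-- The evolution of a multiple of `δ₀`, summed over the endpoint. -/
theorem sum_evo_delta (m : ℕ) (F : ℕ → ZMod 3 → ℝ) (c : ℝ) :
    ∑ z, evo m F (fun z => if z = 0 then c else 0) z
      = ∑ b : Fin m → Bool, c * ∏ i ∈ range m, F (i + 1) (pre m b (i + 1)) := by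
  rw [sum_evo_eq]
  refine sum_congr rfl fun b _ => ?_
  rw [sum_eq_single (0 : ZMod 3)]
  · simp
  · intro z₀ _ hne; simp [hne]
  · simp

/-- The evolution of a multiple of `δ₀`, read at the endpoint `w`. -/
theorem evo_delta_apply (m : ℕ) (F : ℕ → ZMod 3 → ℝ) (c : ℝ) (w : ZMod 3) :
    evo m F (fun z => if z = 0 then c else 0) w
      = ∑ b : Fin m → Bool, if wtZ m b = w then c * ∏ i ∈ range m, F (i + 1) (pre m b (i + 1)) else 0 := by
  rw [evo_eq_pathsum]
  unfold pathsum
  refine sum_congr rfl fun b _ => ?_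
  rw [sum_eq_single (0 : ZMod 3)]
  · simp
  · intro z₀ _ hne; simp [hne]
  · simp

end Summit.QuantumAdvantage.AdviceFreeQNC0.SignWalk
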